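import Summits.QuantumFields.YangMills.Theorems.BalabanUVNodesN16AtTupleReadingBinderGeneric
import Summits.QuantumFields.YangMills.Theorems.BalabanUVNodesN16HolderMSAtTupleReadingBinderGeneric
import Summits.QuantumFields.YangMills.Theorems.BalabanUVNodesN16SlotWindowAllTorus

/-!
# Route «BalabanUVNodes», cluster K4 «SpineRates» — node N16 = NE3: ★ THE N16 LINES IN THE BINDER-GENERIC K3 TUPLE CURRENCY WITH NODE N05's CONJUNCTS AT THE ALL-TORUS
# PROPER SUB-INDEX (R-b″ on N16's record side) — for ANY `(Θ, P)`-keyed tuple reading `rr : (F : T4Family) → (θ : Θ F) → P F θ → (ℕ → ℝ) → List (ULoop F) → RateCarriers N`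
# with ANY admissibility predicate `A`, pinned at RR-1's NE3 object of record: N05's `Thm4Body` ∕ `Prop3Body` on
# `fun i : {i : ZdIdx 4 F.L // (∀ j, i.Ω j = univ) ∧ … ∧ i.η = ((F.L : ℝ)⁻¹) ^ i.k} ↦ zdGF3 (M_N ℂ) F.L β (len F) i.1` + N07's `LeafH3sup`
# + the displayed windowed letter lines, once per family carrying an `A`-admissible (guarded) key ⟹ the N16 conjunct of `KeyedRates rr` (β = 1 ∕ β ∕ multi-scale)

Cell `pub-ymgap`, seat `pub-ymgap-dag-n16-e` (R134 acceleration seat (a), strategy s2 = BY-NAME KNIT at the record; HUMAN RULING D-0062; chair R424 venue), generation 8,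
module 34ᴳᴳ (THEOREMS ONLY, 0 `def`, 0 `sorry`, standard axioms) = the `(Θ, A)`-generalisation of module 34 `…N16AtTupleReadingAllTorus` (p518583: `Θ F = Stage13Params F N`,
`A F θ = θ.Admissible F N` — same statements under that instance, same proofs).  `--kind proof --supports stmt-QuantumFields-20509 --as helper` (K3⁶ `SpineGivenEndpointR13SepCoPR`,
dag-lead WORDS-142).  `bears_on: R4∕N16 · edges N05 → N16, N07 → N16 · out-edge N16 → N21`.  Over modules 21ᴳᴳ `…N16AtTupleReadingBinderGeneric` (p530924: the constant-layer
iffs) ∕ 29ᴳᴳ `…N16HolderMSAtTupleReadingBinderGeneric` (p531947), 33 `…N16SlotWindowAllTorus` (p517690: the STAGE-FREE per-family lemmas at the AT sub-index) and 32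
`…N16LeafSlotAllTorus` (p516759: the closers).  Statements = the six ★ theorems of 21ᴳᴳ∕29ᴳᴳ with the N05 family's index subtype swapped (suffix `_allTorus`); proofs verbatim
with the AT lemmas in place of the univ ones.  Restates nothing; edition-free AND binder-free (`Θ`, `P`, `A` generic) — no record module imported.

WHY (director-ym №174 v1.6 `CoPR`: the binder TYPE moves to `Stage13RParams`, so the `Stage13Params`-typed module 34 does not instantiate at dag-n22-e's `…₁₃CoPR` readings; see
21ᴳᴳ's header.  LOCATED-4 of this seat, modules 32∕33 headers; dag-n16-c g6 p511253 ∕ F45 ∕ F46 ∕ F49: the ★ lines of 21ᴳᴳ∕29ᴳᴳ ask N05's conclusion at EVERY member of the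
univ sub-family, which no printed supplier serves at the degenerate members; these are the same lines with the N05 conjunct n16-c's R-b″ ∕ n05-a's per-member currency
actually produce — WEAKER hypotheses, hence STRONGER theorems; the univ-keyed ★ lines are VACUOUS as stated (F49) and superseded by these.  A K3 composer at any record
edition and binder instantiates `Θ`, `P`, `A` by unification.)

CONTENT.  §1 ★ `n16_tupleReading_ofRecord_of_window_linear_allTorus` ∕ ★ `n16_tupleReadingOn_ofRecord_of_window_linear_allTorus` (β = 1, thresholds `radiusOfRecord` ∕
`constOfRecord`); §2 ★ `n16Holder_tupleReading_ofRecord_of_window_linear_allTorus` ∕ ★ `n16Holder_tupleReadingOn_ofRecord_of_window_linear_allTorus` (`β ∈ [0, 1]`,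
`radiusOfRecordH` ∕ `constOfRecordH`); §3 ★ `n16HolderMS_tupleReading_ofRecord_of_window_linear_allTorus` ∕ ★ `n16HolderMS_tupleReadingOn_ofRecord_of_window_linear_allTorus`
(multi-scale, `radiusOfRecordHMS` ∕ `constOfRecordHMS`, length letter `len F (j • e μ) = j`).

HONEST FRAMING.  Kernel bookkeeping by name; no estimate; N05's `Thm4Body` ∕ `Prop3Body` ([Balaban1985RegularSpaces] Thm 4 ∕ Prop 3 TYPES at the all-torus proper members)
and N07's `LeafH3sup` ([Balaban1985Variational] Thm 1 (8)+(10) TYPE) are HYPOTHESES asserted for no family; the reading `rr`, the key type `Θ`, the proviso `P`, the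
admissibility `A`, the letters are PARAMETERS on displayed lines; no admissible key with ANY proviso is claimed to exist (K0 OPEN at every edition); the (42)∕(0.4) averaging
transfer (N21's `hdict`) and the Hölder-pin ruling untouched; nothing of Bałaban's asserted; **N16 ∕ NE3 is NOT discharged**; no `stub_rates13` claimed; count-neutral (typed
28∕28 · discharged 5∕27, A 5∕28 UNMOVED); one finite four-torus at fixed ε — NOT ℝ⁴, NOT infinite volume, NOT OS, NOT a mass gap, NOT Clay.
-/

set_option autoImplicit false

open scoped BigOperators Matrix Matrix.Norms.L2Operator
open NormedSpace

namespace Summit.QuantumFields.YangMills.BalabanUVNodes.N16AtTupleReadingAllTorusBinderGeneric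

open Literature.MathematicalPhysics.QuantumFieldTheory.Balaban1983to89
open Literature.MathematicalPhysics.QuantumFieldTheory.Balaban1983to89.T4Continuum (T4Family ULoop)
open B7Prop1Explicit B7Prop2Explicit
open B7Prop3Flat (c3)
open B8LeafModelZd (ZdIdx)
open B8LeafModelZd3 (zdGF3)
open Node00 (NE3Objects₁₁ NE3Letters₁₁ ne3LOfRecord₁₁ ne3ConstLayerOfRecord₁₁ ne3NperOfRecord₁₁ ne3DomOfRecord₁₁)
open Summit.QuantumFields.BalabanUV.T4Continuum
open BlockAverageCurrent (curConst)
open NE3RightInverseSupLetters (frameC)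
open NE3.LeafIndexSockets (LeafH3sup)
open YMDAG.UVSplit (NE3Carriers RateCarriers N16At ne3OfRecord₁₁)
open Summit.QuantumFields.YangMills.BalabanUVNodes.N16Regime (InEndRegime radiusOfRecord constOfRecord)
open Summit.QuantumFields.YangMills.BalabanUVNodes.N16HolderDefs (N16HolderAt)
open Summit.QuantumFields.YangMills.BalabanUVNodes.N16HolderMSDefs (N16HolderMSAt)
open Summit.QuantumFields.YangMills.BalabanUVNodes.N16HolderRegime (InEndRegimeH radiusOfRecordH constOfRecordH)
open Summit.QuantumFields.YangMills.BalabanUVNodes.N16HolderMSRegime (radiusOfRecordHMS constOfRecordHMS)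
open Summit.QuantumFields.YangMills.BalabanUVNodes.N16LeafSlotAllTorus (n16At_of_inEndRegime_leafSlotAT n16HolderAt_of_inEndRegimeH_leafSlotHolderAT
  n16HolderMSAt_of_inEndRegimeHMS_leafSlotHolderMSAT)
open Summit.QuantumFields.YangMills.BalabanUVNodes.N16SlotWindowAllTorus (inEndRegime_and_leafSlotAT_ofRecord_of_window_linear
  inEndRegimeH_and_leafSlotHolderAT_ofRecord_of_window_linear inEndRegimeHMS_and_leafSlotHolderMSAT_ofRecord_of_window_linear)
open Summit.QuantumFields.YangMills.BalabanUVNodes.N16AtTupleReadingBinderGeneric (n16_tupleReading_iff_of_constLayer n16_tupleReadingOn_iff_of_constLayer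
  n16Holder_tupleReading_iff_ofRecord)
open Summit.QuantumFields.YangMills.BalabanUVNodes.N16HolderMSAtTupleReadingBinderGeneric (n16HolderMS_tupleReading_iff_ofRecord n16HolderMS_tupleReadingOn_iff_ofRecord)

noncomputable section

variable {N : ℕ} [NeZero N] {Θ : T4Family → Type*} {P A : (F : T4Family) → Θ F → Prop}
  (rr : (F : T4Family) → (θ : Θ F) → P F θ → (ℕ → ℝ) → List (ULoop F) → RateCarriers N)
  (Rg : (F : T4Family) → Θ F → Prop)

/-! ## §1 At RR-1's NE3 object of record: THE N16 LINE (β = 1) and THE N16 LINE at exponent `β`, N05 conjuncts at the all-torus proper members -/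

section LinesOneAndHolder

variable (ℓ : T4Family → NE3Letters₁₁)
  (hpin : ∀ (F : T4Family) (θ : Θ F) (hP : P F θ) (g₀ : ℕ → ℝ) (os : List (ULoop F)),
    (rr F θ hP g₀ os).ne3 = ne3OfRecord₁₁ F (ne3ConstLayerOfRecord₁₁ F N (ℓ F)))
include hpin

variable
  -- N05's constants, per family; the averaging letter in N05's window and N07's leaf letters, per family (this seat's file 17, verbatim)
  {len : T4Family → Site 4 → ℝ} {c₁ c₁' B₁' cP C₂ B₀β : T4Family → ℝ} {inp : T4Family → B8.B9Inputs} {α b' c' : T4Family → ℝ}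
  (hlen : ∀ (F : T4Family) (v : Site 4), 0 < len F v → 1 ≤ len F v) (hlen1 : ∀ (F : T4Family) (μ : Fin 4), len F (e μ) = 1)
  (hB₁' : ∀ F, 0 < B₁' F) (hBB : ∀ F : T4Family, 5 * ((4 : ℕ) : ℝ) * F.L * (inp F).B₀ ≤ B₁' F) (hc₁' : ∀ F, 0 < c₁' F)
  (hwin : ∀ (F : T4Family) (α₀ α₁ : ℝ), 0 < α₀ → 0 < α₁ → α₀ + α₁ ≤ c₁' F →
    α₀ + α₁ ≤ c₁ F ∧ C0 4 * (2 * α₀) ≤ 1 / 3 ∧ 4 * α₀ ≤ c2' 4 F.L ∧ 16 * (B₁' F * (α₀ + α₁)) ≤ 1 ∧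
    Real.exp (4 * (800 * (((4 : ℕ) : ℝ) + 1) ^ 2 * (((4 : ℕ) : ℝ) + 4)) * α₀) * (1 + 8 * (131072 * (((4 : ℕ) : ℝ) + 1) ^ 2) * (B₁' F * (α₀ + α₁))) ≤ 2 ∧
    2 * (B₁' F * (α₀ + α₁)) ≤ c3 4 F.L ∧ ((4 : ℕ) : ℝ) * F.L * α₁ ≤ 1 / 8 ∧ α₀ ≤ cP F ∧ α₁ ≤ cP F ∧ B₁' F * (α₀ + α₁) ≤ cP F ∧
    2 * (B₁' F * (α₀ + α₁)) ^ 2 + 20 * ((4 : ℕ) : ℝ) * α₀ * (B₁' F * (α₀ + α₁)) + 2 * C₂ F * (B₁' F * (α₀ + α₁)) ^ 2 ≤ α₀ + α₁)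
  (hα : ∀ F, 0 < α F) (hα1 : ∀ F, α F ≤ c₁' F / 177)
  (hα2 : ∀ F : T4Family, α F ≤ (ℓ F).Λ₁ / (1770 * (5 * ((4 : ℕ) : ℝ) * F.L * (inp F).B₀) + 1))
  (hα3 : ∀ F : T4Family, α F ≤ c2' 4 F.L / 2)
  (hα4 : ∀ F : T4Family, α F ≤ 1 / ((23040 * (4 : ℝ) ^ 4 * (frameC 4 F.L + 4) ^ 3 + 12) * (1 + curConst 4 F.L) + 1))
  (hα5 : ∀ F, α F ≤ 1 / 10 ^ 9)
  (hg : ∀ F, 0 < (ℓ F).g) (hε0 : ∀ F, 0 < (ℓ F).ε) (hε : ∀ F, (ℓ F).ε < α F)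
  (hb : ∀ F, 0 ≤ (ℓ F).b ∧ (ℓ F).b ≤ (ℓ F).ε / 2)
  (hΛ₂' : ∀ F : T4Family, 177 * α F * (5 * ((4 : ℕ) : ℝ) * F.L * B₀β F + 5 * ((4 : ℕ) : ℝ) * F.L * (inp F).B₀) ≤ (ℓ F).Λ₂')
  (hb' : ∀ F, 0 ≤ b' F ∧ b' F ≤ α F / 2048) (hc' : ∀ F, 0 ≤ c' F ∧ c' F ≤ α F / 24)

section RecordExponent

variable (hΛ₁r : ∀ F : T4Family, (ℓ F).Λ₁ ≤ radiusOfRecord N F.L (ne3NperOfRecord₁₁ F 0 0))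
  (hC : ∀ F : T4Family, constOfRecord N F.L (ne3NperOfRecord₁₁ F 0 0) (ℓ F).g ≤ (ℓ F).C)
include hlen hlen1 hB₁' hBB hc₁' hwin hα hα1 hα2 hα3 hα4 hα5 hg hε0 hε hb hΛ₂' hb' hc' hΛ₁r hC

/-- ★ **THE N16 LINE IN THE K3 TUPLE CURRENCY, ANY KEY TYPE `Θ`, PROVISO `P`, ADMISSIBILITY `A`** — for ANY `(Θ, P)`-keyed tuple reading `rr` pinned at RR-1's object of record with windowed letters `ℓ F`, the three content clauses
(N05's `Thm4Body` ∕ `Prop3Body` on the ALL-TORUS PROPER sub-family of `zdGF3 (M_N ℂ) F.L 1 (len F)`, N07's `LeafH3sup` at `(ℓ F).ε, b' F, c' F`) ONCE per family carrying an `A`-admissible key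
with proviso `P` give the N16 conjunct of `KeyedRates rr` — `∀ F θ hP, A F θ → ∀ g₀ os, N16At (rr F θ hP g₀ os).ne3`; every other hypothesis is a displayed letter line
(module 33's STAGE-FREE per-family lemma `inEndRegime_and_leafSlotAT_ofRecord_of_window_linear`, module 32's closer `n16At_of_inEndRegime_leafSlotAT`). [folklore] -/
theorem n16_tupleReading_ofRecord_of_window_linear_allTorus
    (hcontent : ∀ (F : T4Family), (∃ θ : Θ F, P F θ ∧ A F θ) →
      letI : CStarAlgebra (Matrix (Fin N) (Fin N) ℂ) := {}
      B8.Thm4Body (c₁ F) (B₁' F) (fun i : {i : ZdIdx 4 F.L // (∀ j, i.Ω j = Set.univ) ∧ (∀ m j, i.Λs m j = {_y | j = m}) ∧ (∀ m j, i.Λb m j = {_c | j = m}) ∧ i.η = ((F.L : ℝ)⁻¹) ^ i.k} => (zdGF3 (Matrix (Fin N) (Fin N) ℂ) F.L 1 (len F) i.1).toGFData) ∧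
        B8.Prop3Body (cP F) 4 (F.L : ℝ) (C₂ F) (inp F) (B₀β F)
          (fun i : {i : ZdIdx 4 F.L // (∀ j, i.Ω j = Set.univ) ∧ (∀ m j, i.Λs m j = {_y | j = m}) ∧ (∀ m j, i.Λb m j = {_c | j = m}) ∧ i.η = ((F.L : ℝ)⁻¹) ^ i.k} => (zdGF3 (Matrix (Fin N) (Fin N) ℂ) F.L 1 (len F) i.1).toGFData2) ∧
        LeafH3sup 4 F.L (ne3NperOfRecord₁₁ F 0 0) (ℓ F).ε (b' F) (c' F) (ne3DomOfRecord₁₁ F N 0 0)) :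
    ∀ (F : T4Family) (θ : Θ F) (hP : P F θ), A F θ → ∀ (g₀ : ℕ → ℝ) (os : List (ULoop F)), N16At (rr F θ hP g₀ os).ne3 :=
  (n16_tupleReading_iff_of_constLayer rr (fun F => ne3ConstLayerOfRecord₁₁ F N (ℓ F)) hpin).2 fun F hF =>
    have h := inEndRegime_and_leafSlotAT_ofRecord_of_window_linear ℓ hlen hlen1 hB₁' hBB hc₁' hwin hα hα1 hα2 hα3 hα4 hα5 hg hε0 hε hΛ₁r hb hC hΛ₂' hb' hc' F
      (hcontent F hF).1 (hcontent F hF).2.1 (hcontent F hF).2.2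
    n16At_of_inEndRegime_leafSlotAT h.1 h.2

/-- ★ **THE N16 LINE IN THE GUARDED θ-FORM** — the same with a regime `Rg F θ` inside the binder; content asked only of families carrying a GUARDED `A`-admissible key with
proviso `P` (e.g. RR-2's guard of record of the edition: `θ.ZtUnity F N ∧ θ.SlotsNondegenerate₁₃ F N` at ⁵, `θ.ZrUnity F N ∧ …` at ⁶). [folklore] -/
theorem n16_tupleReadingOn_ofRecord_of_window_linear_allTorus
    (hcontent : ∀ (F : T4Family), (∃ θ : Θ F, P F θ ∧ Rg F θ ∧ A F θ) →
      letI : CStarAlgebra (Matrix (Fin N) (Fin N) ℂ) := {}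
      B8.Thm4Body (c₁ F) (B₁' F) (fun i : {i : ZdIdx 4 F.L // (∀ j, i.Ω j = Set.univ) ∧ (∀ m j, i.Λs m j = {_y | j = m}) ∧ (∀ m j, i.Λb m j = {_c | j = m}) ∧ i.η = ((F.L : ℝ)⁻¹) ^ i.k} => (zdGF3 (Matrix (Fin N) (Fin N) ℂ) F.L 1 (len F) i.1).toGFData) ∧
        B8.Prop3Body (cP F) 4 (F.L : ℝ) (C₂ F) (inp F) (B₀β F)
          (fun i : {i : ZdIdx 4 F.L // (∀ j, i.Ω j = Set.univ) ∧ (∀ m j, i.Λs m j = {_y | j = m}) ∧ (∀ m j, i.Λb m j = {_c | j = m}) ∧ i.η = ((F.L : ℝ)⁻¹) ^ i.k} => (zdGF3 (Matrix (Fin N) (Fin N) ℂ) F.L 1 (len F) i.1).toGFData2) ∧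
        LeafH3sup 4 F.L (ne3NperOfRecord₁₁ F 0 0) (ℓ F).ε (b' F) (c' F) (ne3DomOfRecord₁₁ F N 0 0)) :
    ∀ (F : T4Family) (θ : Θ F) (hP : P F θ), Rg F θ → A F θ →
      ∀ (g₀ : ℕ → ℝ) (os : List (ULoop F)), N16At (rr F θ hP g₀ os).ne3 :=
  (n16_tupleReadingOn_iff_of_constLayer rr Rg (fun F => ne3ConstLayerOfRecord₁₁ F N (ℓ F)) hpin).2 fun F hF =>
    have h := inEndRegime_and_leafSlotAT_ofRecord_of_window_linear ℓ hlen hlen1 hB₁' hBB hc₁' hwin hα hα1 hα2 hα3 hα4 hα5 hg hε0 hε hΛ₁r hb hC hΛ₂' hb' hc' F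
      (hcontent F hF).1 (hcontent F hF).2.1 (hcontent F hF).2.2
    n16At_of_inEndRegime_leafSlotAT h.1 h.2

end RecordExponent

/-! ## §2 At a printed Hölder exponent `β ∈ [0, 1]` (dag-n16-c's `N16HolderAt · β`; R-β unruled), N05 conjuncts at the all-torus proper members -/

section HolderExponent

variable {β : ℝ} (hβ0 : 0 ≤ β) (hβ1 : β ≤ 1)
  (hΛ₁rH : ∀ F : T4Family, (ℓ F).Λ₁ ≤ radiusOfRecordH N F.L (ne3NperOfRecord₁₁ F 0 0))
  (hCH : ∀ F : T4Family, constOfRecordH N F.L (ne3NperOfRecord₁₁ F 0 0) (ℓ F).g ≤ (ℓ F).C)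
include hβ0 hβ1 hlen hlen1 hB₁' hBB hc₁' hwin hα hα1 hα2 hα3 hα4 hα5 hg hε0 hε hb hΛ₂' hb' hc' hΛ₁rH hCH

/-- ★ **THE N16 LINE AT EXPONENT `β ∈ [0, 1]` IN THE K3 TUPLE CURRENCY, ANY KEY TYPE `Θ`, PROVISO `P`, ADMISSIBILITY `A`** — N05's family at `zdGF3 (M_N ℂ) F.L β (len F)`, (E1)'s β-uniform thresholds `radiusOfRecordH` ∕
`constOfRecordH`, N07's leaf letters linear; the three content clauses once per family carrying an `A`-admissible key with proviso `P` give the β-conjunct at the tuple reading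
(module 33's `inEndRegimeH_and_leafSlotHolderAT_ofRecord_of_window_linear`, module 32's closer `n16HolderAt_of_inEndRegimeH_leafSlotHolderAT`). [folklore] -/
theorem n16Holder_tupleReading_ofRecord_of_window_linear_allTorus
    (hcontent : ∀ (F : T4Family), (∃ θ : Θ F, P F θ ∧ A F θ) →
      letI : CStarAlgebra (Matrix (Fin N) (Fin N) ℂ) := {}
      B8.Thm4Body (c₁ F) (B₁' F) (fun i : {i : ZdIdx 4 F.L // (∀ j, i.Ω j = Set.univ) ∧ (∀ m j, i.Λs m j = {_y | j = m}) ∧ (∀ m j, i.Λb m j = {_c | j = m}) ∧ i.η = ((F.L : ℝ)⁻¹) ^ i.k} => (zdGF3 (Matrix (Fin N) (Fin N) ℂ) F.L β (len F) i.1).toGFData) ∧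
        B8.Prop3Body (cP F) 4 (F.L : ℝ) (C₂ F) (inp F) (B₀β F)
          (fun i : {i : ZdIdx 4 F.L // (∀ j, i.Ω j = Set.univ) ∧ (∀ m j, i.Λs m j = {_y | j = m}) ∧ (∀ m j, i.Λb m j = {_c | j = m}) ∧ i.η = ((F.L : ℝ)⁻¹) ^ i.k} => (zdGF3 (Matrix (Fin N) (Fin N) ℂ) F.L β (len F) i.1).toGFData2) ∧
        LeafH3sup 4 F.L (ne3NperOfRecord₁₁ F 0 0) (ℓ F).ε (b' F) (c' F) (ne3DomOfRecord₁₁ F N 0 0)) :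
    ∀ (F : T4Family) (θ : Θ F) (hP : P F θ), A F θ →
      ∀ (g₀ : ℕ → ℝ) (os : List (ULoop F)), N16HolderAt (rr F θ hP g₀ os).ne3 β :=
  (n16Holder_tupleReading_iff_ofRecord rr ℓ β hpin).2 fun F hF =>
    have h := inEndRegimeH_and_leafSlotHolderAT_ofRecord_of_window_linear ℓ hlen hlen1 hB₁' hBB hc₁' hwin hα hα1 hα2 hα3 hα4 hα5 hg hε0 hε hΛ₁rH hb hCH hΛ₂' hb' hc' F
      (hcontent F hF).1 (hcontent F hF).2.1 (hcontent F hF).2.2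
    n16HolderAt_of_inEndRegimeH_leafSlotHolderAT h.1 hβ0 hβ1 h.2

/-- ★ **THE N16 LINE AT EXPONENT `β`, GUARDED θ-FORM** (regime `Rg F θ` inside the binder). [folklore] -/
theorem n16Holder_tupleReadingOn_ofRecord_of_window_linear_allTorus
    (hcontent : ∀ (F : T4Family), (∃ θ : Θ F, P F θ ∧ Rg F θ ∧ A F θ) →
      letI : CStarAlgebra (Matrix (Fin N) (Fin N) ℂ) := {}
      B8.Thm4Body (c₁ F) (B₁' F) (fun i : {i : ZdIdx 4 F.L // (∀ j, i.Ω j = Set.univ) ∧ (∀ m j, i.Λs m j = {_y | j = m}) ∧ (∀ m j, i.Λb m j = {_c | j = m}) ∧ i.η = ((F.L : ℝ)⁻¹) ^ i.k} => (zdGF3 (Matrix (Fin N) (Fin N) ℂ) F.L β (len F) i.1).toGFData) ∧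
        B8.Prop3Body (cP F) 4 (F.L : ℝ) (C₂ F) (inp F) (B₀β F)
          (fun i : {i : ZdIdx 4 F.L // (∀ j, i.Ω j = Set.univ) ∧ (∀ m j, i.Λs m j = {_y | j = m}) ∧ (∀ m j, i.Λb m j = {_c | j = m}) ∧ i.η = ((F.L : ℝ)⁻¹) ^ i.k} => (zdGF3 (Matrix (Fin N) (Fin N) ℂ) F.L β (len F) i.1).toGFData2) ∧
        LeafH3sup 4 F.L (ne3NperOfRecord₁₁ F 0 0) (ℓ F).ε (b' F) (c' F) (ne3DomOfRecord₁₁ F N 0 0)) :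
    ∀ (F : T4Family) (θ : Θ F) (hP : P F θ), Rg F θ → A F θ →
      ∀ (g₀ : ℕ → ℝ) (os : List (ULoop F)), N16HolderAt (rr F θ hP g₀ os).ne3 β := by
  intro F θ hP hRg hθ g₀ os
  rw [hpin]
  have h := inEndRegimeH_and_leafSlotHolderAT_ofRecord_of_window_linear ℓ hlen hlen1 hB₁' hBB hc₁' hwin hα hα1 hα2 hα3 hα4 hα5 hg hε0 hε hΛ₁rH hb hCH hΛ₂' hb' hc' F
    (hcontent F ⟨θ, hP, hRg, hθ⟩).1 (hcontent F ⟨θ, hP, hRg, hθ⟩).2.1 (hcontent F ⟨θ, hP, hRg, hθ⟩).2.2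
  exact n16HolderAt_of_inEndRegimeH_leafSlotHolderAT h.1 hβ0 hβ1 h.2

end HolderExponent

end LinesOneAndHolder

/-! ## §3 THE MS N16 LINE (R-β″), N05 conjuncts at the all-torus proper members -/

section MSParams

variable (ℓ : T4Family → NE3Letters₁₁) (β : ℝ)

section LinesMS

variable (hpin : ∀ (F : T4Family) (θ : Θ F) (hP : P F θ) (g₀ : ℕ → ℝ) (os : List (ULoop F)),
    (rr F θ hP g₀ os).ne3 = ne3OfRecord₁₁ F (ne3ConstLayerOfRecord₁₁ F N (ℓ F)))
include hpin

variable (hβ0 : 0 ≤ β) (hβ1 : β ≤ 1)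
  -- N05's constants, per family (MS length letter); the averaging letter in N05's window and N07's leaf letters, per family (module 26's STAGE-FREE per-family lemma, verbatim)
  {len : T4Family → Site 4 → ℝ} {c₁ c₁' B₁' cP C₂ B₀β : T4Family → ℝ} {inp : T4Family → B8.B9Inputs} {α b' c' : T4Family → ℝ}
  (hlen : ∀ (F : T4Family) (v : Site 4), 0 < len F v → 1 ≤ len F v) (hlenj : ∀ (F : T4Family) (μ : Fin 4) (j : ℕ), len F (j • e μ) = j)
  (hB₁' : ∀ F, 0 < B₁' F) (hBB : ∀ F : T4Family, 5 * ((4 : ℕ) : ℝ) * F.L * (inp F).B₀ ≤ B₁' F) (hc₁' : ∀ F, 0 < c₁' F)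
  (hwin : ∀ (F : T4Family) (α₀ α₁ : ℝ), 0 < α₀ → 0 < α₁ → α₀ + α₁ ≤ c₁' F →
    α₀ + α₁ ≤ c₁ F ∧ C0 4 * (2 * α₀) ≤ 1 / 3 ∧ 4 * α₀ ≤ c2' 4 F.L ∧ 16 * (B₁' F * (α₀ + α₁)) ≤ 1 ∧
    Real.exp (4 * (800 * (((4 : ℕ) : ℝ) + 1) ^ 2 * (((4 : ℕ) : ℝ) + 4)) * α₀) * (1 + 8 * (131072 * (((4 : ℕ) : ℝ) + 1) ^ 2) * (B₁' F * (α₀ + α₁))) ≤ 2 ∧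
    2 * (B₁' F * (α₀ + α₁)) ≤ c3 4 F.L ∧ ((4 : ℕ) : ℝ) * F.L * α₁ ≤ 1 / 8 ∧ α₀ ≤ cP F ∧ α₁ ≤ cP F ∧ B₁' F * (α₀ + α₁) ≤ cP F ∧
    2 * (B₁' F * (α₀ + α₁)) ^ 2 + 20 * ((4 : ℕ) : ℝ) * α₀ * (B₁' F * (α₀ + α₁)) + 2 * C₂ F * (B₁' F * (α₀ + α₁)) ^ 2 ≤ α₀ + α₁)
  (hα : ∀ F, 0 < α F) (hα1 : ∀ F, α F ≤ c₁' F / 177)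
  (hα2 : ∀ F : T4Family, α F ≤ (ℓ F).Λ₁ / (1770 * (5 * ((4 : ℕ) : ℝ) * F.L * (inp F).B₀) + 1))
  (hα3 : ∀ F : T4Family, α F ≤ c2' 4 F.L / 2)
  (hα4 : ∀ F : T4Family, α F ≤ 1 / ((23040 * (4 : ℝ) ^ 4 * (frameC 4 F.L + 4) ^ 3 + 12) * (1 + curConst 4 F.L) + 1))
  (hα5 : ∀ F, α F ≤ 1 / 10 ^ 9)
  (hg : ∀ F, 0 < (ℓ F).g) (hε0 : ∀ F, 0 < (ℓ F).ε) (hε : ∀ F, (ℓ F).ε < α F)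
  (hΛ₁r : ∀ F : T4Family, (ℓ F).Λ₁ ≤ radiusOfRecordHMS N F.L (ne3NperOfRecord₁₁ F 0 0))
  (hb : ∀ F, 0 ≤ (ℓ F).b ∧ (ℓ F).b ≤ (ℓ F).ε / 2) (hC : ∀ F : T4Family, constOfRecordHMS N F.L (ne3NperOfRecord₁₁ F 0 0) (ℓ F).g ≤ (ℓ F).C)
  (hΛ₂' : ∀ F : T4Family, 177 * α F * (5 * ((4 : ℕ) : ℝ) * F.L * B₀β F + 5 * ((4 : ℕ) : ℝ) * F.L * (inp F).B₀) ≤ (ℓ F).Λ₂')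
  (hb' : ∀ F, 0 ≤ b' F ∧ b' F ≤ α F / 2048) (hc' : ∀ F, 0 ≤ c' F ∧ c' F ≤ α F / 24)
include hβ0 hβ1 hlen hlenj hB₁' hBB hc₁' hwin hα hα1 hα2 hα3 hα4 hα5 hg hε0 hε hΛ₁r hb hC hΛ₂' hb' hc'

/-- ★ **THE MS N16 LINE IN THE K3 TUPLE CURRENCY, ANY KEY TYPE `Θ`, PROVISO `P`, ADMISSIBILITY `A`, UNGUARDED** — for ANY `P`-keyed tuple reading `rr` pinned at RR-1's object with windowed letters `ℓ F`, the three content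
clauses ONCE per family carrying an `A`-admissible key with proviso `P` give the MS β-conjunct «`∀ F θ (hP : P F θ), A F θ → ∀ g₀ os, N16HolderMSAt (rr F θ hP g₀ os).ne3 β`»
(module 33's STAGE-FREE `inEndRegimeHMS_and_leafSlotHolderMSAT_ofRecord_of_window_linear` per family, module 32's closer). [folklore] -/
theorem n16HolderMS_tupleReading_ofRecord_of_window_linear_allTorus
    (hcontent : ∀ (F : T4Family), (∃ θ : Θ F, P F θ ∧ A F θ) →
      letI : CStarAlgebra (Matrix (Fin N) (Fin N) ℂ) := {}
      B8.Thm4Body (c₁ F) (B₁' F) (fun i : {i : ZdIdx 4 F.L // (∀ j, i.Ω j = Set.univ) ∧ (∀ m j, i.Λs m j = {_y | j = m}) ∧ (∀ m j, i.Λb m j = {_c | j = m}) ∧ i.η = ((F.L : ℝ)⁻¹) ^ i.k} => (zdGF3 (Matrix (Fin N) (Fin N) ℂ) F.L β (len F) i.1).toGFData) ∧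
        B8.Prop3Body (cP F) 4 (F.L : ℝ) (C₂ F) (inp F) (B₀β F)
          (fun i : {i : ZdIdx 4 F.L // (∀ j, i.Ω j = Set.univ) ∧ (∀ m j, i.Λs m j = {_y | j = m}) ∧ (∀ m j, i.Λb m j = {_c | j = m}) ∧ i.η = ((F.L : ℝ)⁻¹) ^ i.k} => (zdGF3 (Matrix (Fin N) (Fin N) ℂ) F.L β (len F) i.1).toGFData2) ∧
        LeafH3sup 4 F.L (ne3NperOfRecord₁₁ F 0 0) (ℓ F).ε (b' F) (c' F) (ne3DomOfRecord₁₁ F N 0 0)) :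
    ∀ (F : T4Family) (θ : Θ F) (hP : P F θ), A F θ →
      ∀ (g₀ : ℕ → ℝ) (os : List (ULoop F)), N16HolderMSAt (rr F θ hP g₀ os).ne3 β :=
  (n16HolderMS_tupleReading_iff_ofRecord rr ℓ β hpin).2 fun F hF =>
    have h := inEndRegimeHMS_and_leafSlotHolderMSAT_ofRecord_of_window_linear ℓ hlen hlenj hB₁' hBB hc₁' hwin hα hα1 hα2 hα3 hα4 hα5 hg hε0 hε hΛ₁r hb hC hΛ₂' hb' hc' F
      (hcontent F hF).1 (hcontent F hF).2.1 (hcontent F hF).2.2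
    n16HolderMSAt_of_inEndRegimeHMS_leafSlotHolderMSAT h.1 hβ0 hβ1 h.2

/-- ★ **THE MS N16 LINE IN THE K3 TUPLE CURRENCY, ANY KEY TYPE `Θ`, PROVISO `P`, ADMISSIBILITY `A`, GUARDED θ-FORM** (regime `Rg F θ` inside the binder; content asked only of GUARDED families). [folklore] -/
theorem n16HolderMS_tupleReadingOn_ofRecord_of_window_linear_allTorus
    (hcontent : ∀ (F : T4Family), (∃ θ : Θ F, P F θ ∧ Rg F θ ∧ A F θ) →
      letI : CStarAlgebra (Matrix (Fin N) (Fin N) ℂ) := {}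
      B8.Thm4Body (c₁ F) (B₁' F) (fun i : {i : ZdIdx 4 F.L // (∀ j, i.Ω j = Set.univ) ∧ (∀ m j, i.Λs m j = {_y | j = m}) ∧ (∀ m j, i.Λb m j = {_c | j = m}) ∧ i.η = ((F.L : ℝ)⁻¹) ^ i.k} => (zdGF3 (Matrix (Fin N) (Fin N) ℂ) F.L β (len F) i.1).toGFData) ∧
        B8.Prop3Body (cP F) 4 (F.L : ℝ) (C₂ F) (inp F) (B₀β F)
          (fun i : {i : ZdIdx 4 F.L // (∀ j, i.Ω j = Set.univ) ∧ (∀ m j, i.Λs m j = {_y | j = m}) ∧ (∀ m j, i.Λb m j = {_c | j = m}) ∧ i.η = ((F.L : ℝ)⁻¹) ^ i.k} => (zdGF3 (Matrix (Fin N) (Fin N) ℂ) F.L β (len F) i.1).toGFData2) ∧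
        LeafH3sup 4 F.L (ne3NperOfRecord₁₁ F 0 0) (ℓ F).ε (b' F) (c' F) (ne3DomOfRecord₁₁ F N 0 0)) :
    ∀ (F : T4Family) (θ : Θ F) (hP : P F θ), Rg F θ → A F θ →
      ∀ (g₀ : ℕ → ℝ) (os : List (ULoop F)), N16HolderMSAt (rr F θ hP g₀ os).ne3 β :=
  (n16HolderMS_tupleReadingOn_iff_ofRecord rr Rg ℓ β hpin).2 fun F hF =>
    have h := inEndRegimeHMS_and_leafSlotHolderMSAT_ofRecord_of_window_linear ℓ hlen hlenj hB₁' hBB hc₁' hwin hα hα1 hα2 hα3 hα4 hα5 hg hε0 hε hΛ₁r hb hC hΛ₂' hb' hc' F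
      (hcontent F hF).1 (hcontent F hF).2.1 (hcontent F hF).2.2
    n16HolderMSAt_of_inEndRegimeHMS_leafSlotHolderMSAT h.1 hβ0 hβ1 h.2

end LinesMS

end MSParams

end

end Summit.QuantumFields.YangMills.BalabanUVNodes.N16AtTupleReadingAllTorusBinderGeneric
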